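import Literature.Topology.FourManifolds.CuspWhitneyData
import Literature.Topology.FourManifolds.FoldChartSigPoint
import Mathlib.Geometry.Manifold.Instances.Sphere
import HarnessLib

/-!
# Normal forms of a generic map from a closed 4-manifold to the plane

Topic `Literature/Topology/FourManifolds` (programme of the fact
`Literature.Topology.FourManifolds.exists_isSimplifiedBrokenLefschetzFibration`, Baykur–Saeki 2017, §2.1
p. 6: *"The singularities of a generic map `f : X → Σ` are folds and cusps"*, modelled on
`(t, ±x² ± y² ± z²)` and `(t, x³ + tx ± y² ± z²)`; the starting point of the proof of their
Thm. 6.1, §6 p. 19).  Final synthesis of the lane: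

* `exists_contDiff_eventuallyEq_planeRep` — a `C^∞` germ on an open set of `ℝ⁴` is the germ
  of a global `C^∞` map (smooth cut-off);
* **`exists_generic_map_normalForms`** (chart representatives), **`exists_generic_map_of_chart`**,
  **`exists_generic_map_manifoldNormalForms`** (charts of `M`, target `ℝ²`) and
  **`exists_generic_map_sphere`** (target `S²`, the form Baykur–Saeki start from) — every compact
  boundaryless `C^∞` 4-manifold carries a
  `C^∞` map `f : M → ℝ²` such that at every point `q`, a global `C^∞` representative `G` of the
  germ of `f ∘ φ_q⁻¹` at `φ_q q` is a submersion there, or has a **fold chart**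
  `(t, s₁x² + s₂y² + s₃z²)`, `sᵢ = ±1` (`HasFoldChartSig`), or has **Whitney cusp data**
  (`HasWhitneyCuspData`: centred charts with `G = (t, h(t,x) + ε₂y² + ε₃z²)`,
  `h = hₜ = hₓ = hₓₓ = 0`, `hₓₓₓ ≠ 0`, `hₜₓ ≠ 0` at `0`) — from which Whitney's planar theorem
  (Golubitsky–Guillemin VI Thm. 2.4, via the Malgrange preparation theorem; not formalised)
  produces the cusp chart `(t, x³ + tx + ε₂y² + ε₃z²)`.

Everything is proved; no definitions, no named facts (D-0026).

## References

* R. İ. Baykur, O. Saeki, *Simplifying indefinite fibrations on 4-manifolds*, arXiv:1705.11169,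
  §2.1 p. 6, §6 p. 19. [BaykurSaeki2017]
* M. Golubitsky, V. Guillemin, *Stable Mappings and Their Singularities*, GTM 14 (1973), Ch. II
  §4 Thm. 4.9; Ch. III §4; Ch. VI §1–§2, §5 Thm. 5.2. [GolubitskyGuillemin1973]
-/

noncomputable section

set_option maxSynthPendingDepth 2

open Set Function Filter Module
open scoped ContDiff Topology Manifold

namespace Literature.Topology.FourManifolds

/-! ### Global representatives of germs and the final synthesis -/

section Synthesis

/-- Local notation for this file: the model space `ℝⁿ = EuclideanSpace ℝ (Fin n)`. -/
local notation "𝔼 " n:arg => EuclideanSpace ℝ (Fin n)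

/-- **A `C^∞` germ on an open set is the germ of a global `C^∞` map** (smooth cut-off).
[folklore] -/
theorem exists_contDiff_eventuallyEq_planeRep {R : 𝔼 4 → 𝔼 2} {T : Set (𝔼 4)}
    (hT : IsOpen T) (hR : ContDiffOn ℝ ∞ R T) {y : 𝔼 4} (hy : y ∈ T) :
    ∃ G : 𝔼 4 → 𝔼 2, ContDiff ℝ ∞ G ∧ G =ᶠ[𝓝 y] R := by
  obtain ⟨χ, hχ, hχt, hχ1⟩ := Literature.Analysis.Calculus.exists_contDiff_bump_nhds hT hy
  refine ⟨fun z => χ z • R z, ?_, ?_⟩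
  · rw [contDiff_iff_contDiffAt]
    intro z
    by_cases hz : z ∈ T
    · exact hχ.contDiffAt.smul (hR.contDiffAt (hT.mem_nhds hz))
    · have hz' : z ∉ tsupport χ := fun h => hz (hχt h)
      have hev : (fun z => χ z • R z) =ᶠ[𝓝 z] fun _ => 0 := by
        filter_upwards [(isClosed_tsupport χ).isOpen_compl.mem_nhds hz'] with w hw
        show χ w • R w = 0
        rw [image_eq_zero_of_notMem_tsupport hw, zero_smul]
      exact (contDiffAt_const (c := (0 : 𝔼 2))).congr_of_eventuallyEq hev
  · filter_upwards [hχ1] with z hz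
    show χ z • R z = R z
    rw [hz, one_smul]

/-- **Normal forms of a generic map of a closed 4-manifold to the plane** (Thom–Whitney
genericity as used by Baykur–Saeki §2.1: "the singularities of a generic map are folds and
cusps").  On every compact boundaryless `C^∞` manifold modelled on `ℝ⁴` there is a `C^∞` map
`f : M → ℝ²` such that for every point `q` some global `C^∞` representative `G` of the germ of
`f ∘ φ_q⁻¹` at `y = φ_q q` is: a submersion at `y`; or has a fold chart of signature
`(s₁, s₂, s₃)`, `sᵢ = ±1`, at `y` (`G = (t, s₁x² + s₂y² + s₃z²)` in centred smooth charts); or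
has Whitney cusp data at `y` (`G = (t, h(t,x) + ε₂y² + ε₃z²)` with
`h = hₜ = hₓ = hₓₓ = 0`, `hₓₓₓ ≠ 0`, `hₜₓ ≠ 0` at `0`).
[cite: BaykurSaeki2017, §2.1 p. 6, §6 p. 19]
[cite: GolubitskyGuillemin1973, Ch. II §4 Thm. 4.9; Ch. III §4; Ch. VI §2, §5 Thm. 5.2] -/
theorem exists_generic_map_normalForms (M : Type*) [TopologicalSpace M] [T2Space M]
    [CompactSpace M] [ChartedSpace (𝔼 4) M] [IsManifold (𝓡 4) ∞ M] :
    ∃ f : M → 𝔼 2, ContMDiff (𝓡 4) (𝓡 2) ∞ f ∧ ∀ q : M,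
      ∃ G : 𝔼 4 → 𝔼 2, ContDiff ℝ ∞ G ∧
        G =ᶠ[𝓝 (extChartAt (𝓡 4) q q)] (f ∘ (extChartAt (𝓡 4) q).symm) ∧
        (Surjective (fderiv ℝ G (extChartAt (𝓡 4) q q)) ∨
          (∃ s₁ s₂ s₃ : ℝ, s₁ ^ 2 = 1 ∧ s₂ ^ 2 = 1 ∧ s₃ ^ 2 = 1 ∧
            HasFoldChartSig G (extChartAt (𝓡 4) q q) s₁ s₂ s₃) ∨
          HasWhitneyCuspData G (extChartAt (𝓡 4) q q)) := by
  obtain ⟨f, hf, hgen⟩ := OneJet.exists_twoGeneric_map M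
  refine ⟨f, hf, fun q => ?_⟩
  obtain ⟨hne, htr, hcg⟩ := hgen q
  obtain ⟨G, hG, heq⟩ := exists_contDiff_eventuallyEq_planeRep (isOpen_extChartAt_target q)
    (contDiffOn_comp_extChartAt_symm_target (I := 𝓡 4) hf q) (mem_extChartAt_target q)
  refine ⟨G, hG, heq, ?_⟩
  have hne' : fderiv ℝ G (extChartAt (𝓡 4) q q) ≠ 0 := by rwa [heq.fderiv_eq]
  have htr' : OneJet.IsOneJetTransverseAt G (extChartAt (𝓡 4) q q) :=
    (OneJet.isOneJetTransverseAt_congr_of_eventuallyEq heq).2 htr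
  have hcg' : OneJet.IsCuspGenericAt G (extChartAt (𝓡 4) q q) :=
    (OneJet.isCuspGenericAt_congr_of_eventuallyEq heq).2 hcg
  by_cases hsurj : Surjective (fderiv ℝ G (extChartAt (𝓡 4) q q))
  · exact Or.inl hsurj
  rcases OneJet.isFoldPointAt_or_isCuspCandidateAt hsurj hne' with hfold | hcc
  · exact Or.inr (Or.inl (exists_hasFoldChartSig_of_isFoldPointAt hG hne' hfold))
  · exact Or.inr (Or.inr (hasWhitneyCuspData_of_simpleCusp hG hne' hcc htr' hcg'))

end Synthesis

/-! ### Transport to charts of manifolds -/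

section Transport

/-- Local notation for this file: the model space `ℝⁿ = EuclideanSpace ℝ (Fin n)`. -/
local notation "𝔼 " n:arg => EuclideanSpace ℝ (Fin n)

variable {X : Type*} [TopologicalSpace X] [ChartedSpace (𝔼 4) X]
  {B : Type*} [TopologicalSpace B] [ChartedSpace (𝔼 2) B]

/-- **Regular points in charts**: with smooth charts `Φ₀` of `X` at `p` and `Ψ₀` of `B` with
`f (Φ₀.source) ⊆ Ψ₀.source`, and `G` a map differentiable at `Φ₀ p` with the germ of the local
representative `Ψ₀ ∘ f ∘ Φ₀⁻¹` there, `df_p` (the `mfderiv`) is onto iff `dG_{Φ₀ p}` is onto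
(chain rule, the chart differentials being invertible). [folklore] -/
theorem surjective_mfderiv_iff_of_localRepresentative {f : X → B}
    {Φ₀ : OpenPartialHomeomorph X (𝔼 4)} {Ψ₀ : OpenPartialHomeomorph B (𝔼 2)}
    (hΦ₀ : ContMDiffOn (𝓡 4) (𝓡 4) ∞ Φ₀ Φ₀.source)
    (hΦ₀s : ContMDiffOn (𝓡 4) (𝓡 4) ∞ Φ₀.symm Φ₀.target)
    (hΨ₀ : ContMDiffOn (𝓡 2) (𝓡 2) ∞ Ψ₀ Ψ₀.source)
    (hΨ₀s : ContMDiffOn (𝓡 2) (𝓡 2) ∞ Ψ₀.symm Ψ₀.target)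
    (hmaps : MapsTo f Φ₀.source Ψ₀.source) {p : X} (hp : p ∈ Φ₀.source) {G : 𝔼 4 → 𝔼 2}
    (hGd : DifferentiableAt ℝ G (Φ₀ p)) (hGf : G =ᶠ[𝓝 (Φ₀ p)] (Ψ₀ ∘ f ∘ Φ₀.symm)) :
    Surjective (mfderiv (𝓡 4) (𝓡 2) f p) ↔ Surjective (fderiv ℝ G (Φ₀ p)) := by
  have hΦmd : Φ₀.MDifferentiable (𝓡 4) (𝓡 4) :=
    ⟨hΦ₀.mdifferentiableOn (by simp), hΦ₀s.mdifferentiableOn (by simp)⟩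
  have hΨmd : Ψ₀.MDifferentiable (𝓡 2) (𝓡 2) :=
    ⟨hΨ₀.mdifferentiableOn (by simp), hΨ₀s.mdifferentiableOn (by simp)⟩
  have hG0 : G (Φ₀ p) = Ψ₀ (f p) := by
    rw [hGf.eq_of_nhds]
    simp only [Function.comp_apply, Φ₀.left_inv hp]
  have hyt : G (Φ₀ p) ∈ Ψ₀.target := hG0 ▸ Ψ₀.map_source (hmaps hp)
  have hGm : HasMFDerivAt (𝓡 4) (𝓡 2) G (Φ₀ p) (fderiv ℝ G (Φ₀ p)) :=
    hGd.hasFDerivAt.hasMFDerivAt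
  have hΦq : HasMFDerivAt (𝓡 4) (𝓡 4) Φ₀ p (mfderiv (𝓡 4) (𝓡 4) Φ₀ p) :=
    (hΦmd.mdifferentiableAt hp).hasMFDerivAt
  have hΨq : HasMFDerivAt (𝓡 2) (𝓡 2) Ψ₀.symm (G (Φ₀ p))
      (mfderiv (𝓡 2) (𝓡 2) Ψ₀.symm (G (Φ₀ p))) :=
    (hΨmd.mdifferentiableAt_symm hyt).hasMFDerivAt
  have hcomp := hΨq.comp p (hGm.comp p hΦq)
  have hev : f =ᶠ[𝓝 p] (Ψ₀.symm ∘ G ∘ Φ₀) := by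
    filter_upwards [(Φ₀.continuousAt hp).eventually hGf, Φ₀.open_source.mem_nhds hp] with q hq hqs
    show f q = Ψ₀.symm (G (Φ₀ q))
    rw [hq]
    simp only [Function.comp_apply, Φ₀.left_inv hqs, Ψ₀.left_inv (hmaps hqs)]
  have key : ⇑(mfderiv (𝓡 4) (𝓡 2) f p) =
      ⇑(mfderiv (𝓡 2) (𝓡 2) Ψ₀.symm (G (Φ₀ p))) ∘ ⇑(fderiv ℝ G (Φ₀ p)) ∘
        ⇑(mfderiv (𝓡 4) (𝓡 4) Φ₀ p) := by
    rw [hev.mfderiv_eq, hcomp.mfderiv]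
    rfl
  rw [key]
  have hA := hΨmd.symm.mfderiv_bijective hyt
  have hC := hΦmd.mfderiv_surjective hp
  constructor
  · intro hs
    exact (hs.of_comp_left hA.1).of_comp
  · intro hD
    exact hA.2.comp (hD.comp hC)

/-- **From a fold chart of the local representative to charts of the manifolds**: if
`Ψ₀ ∘ f ∘ Φ₀⁻¹` has a fold chart of signature `(s₁, s₂, s₃)` at `Φ₀ p` for smooth charts `Φ₀`
of `X` and `Ψ₀` of `B` with `f (Φ₀.source) ⊆ Ψ₀.source`, then `f` has, at `p`, charts `φ` of
`X` (centred) and `ψ` of `B` with `ψ (f q) = ((φ q)₀, s₁ (φ q)₁² + s₂ (φ q)₂² + s₃ (φ q)₃²)`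
on `φ.source`. [cite: BaykurSaeki2017, §2.1] -/
theorem exists_foldChartSig_of_hasFoldChartSig {f : X → B}
    {Φ₀ : OpenPartialHomeomorph X (𝔼 4)} {Ψ₀ : OpenPartialHomeomorph B (𝔼 2)}
    (hΦ₀ : ContMDiffOn (𝓡 4) (𝓡 4) ∞ Φ₀ Φ₀.source)
    (hΦ₀s : ContMDiffOn (𝓡 4) (𝓡 4) ∞ Φ₀.symm Φ₀.target)
    (hΨ₀ : ContMDiffOn (𝓡 2) (𝓡 2) ∞ Ψ₀ Ψ₀.source)
    (hΨ₀s : ContMDiffOn (𝓡 2) (𝓡 2) ∞ Ψ₀.symm Ψ₀.target)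
    (hmaps : MapsTo f Φ₀.source Ψ₀.source) {p : X} (hp : p ∈ Φ₀.source)
    {s₁ s₂ s₃ : ℝ} (hF : HasFoldChartSig (Ψ₀ ∘ f ∘ Φ₀.symm) (Φ₀ p) s₁ s₂ s₃) :
    ∃ (φ : OpenPartialHomeomorph X (𝔼 4)) (ψ : OpenPartialHomeomorph B (𝔼 2)),
      p ∈ φ.source ∧ φ p = 0 ∧ MapsTo f φ.source ψ.source ∧
      ContMDiffOn (𝓡 4) (𝓡 4) ∞ φ φ.source ∧ ContMDiffOn (𝓡 4) (𝓡 4) ∞ φ.symm φ.target ∧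
      ContMDiffOn (𝓡 2) (𝓡 2) ∞ ψ ψ.source ∧ ContMDiffOn (𝓡 2) (𝓡 2) ∞ ψ.symm ψ.target ∧
      ∀ q ∈ φ.source, (ψ (f q)) 0 = (φ q) 0 ∧
        (ψ (f q)) 1 = s₁ * (φ q) 1 ^ 2 + s₂ * (φ q) 2 ^ 2 + s₃ * (φ q) 3 ^ 2 := by
  obtain ⟨φm, ψm, hpm, hpm0, hmapsm, hφm, hφms, hψm, hψms, hid⟩ := hF
  have hφm' : ContMDiffOn (𝓡 4) (𝓡 4) ∞ φm φm.source := contMDiffOn_iff_contDiffOn.2 hφm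
  have hφms' : ContMDiffOn (𝓡 4) (𝓡 4) ∞ φm.symm φm.target := contMDiffOn_iff_contDiffOn.2 hφms
  have hψm' : ContMDiffOn (𝓡 2) (𝓡 2) ∞ ψm ψm.source := contMDiffOn_iff_contDiffOn.2 hψm
  have hψms' : ContMDiffOn (𝓡 2) (𝓡 2) ∞ ψm.symm ψm.target := contMDiffOn_iff_contDiffOn.2 hψms
  have hFq : ∀ q ∈ Φ₀.source, (Ψ₀ ∘ f ∘ Φ₀.symm) (Φ₀ q) = Ψ₀ (f q) := fun q hq => by
    simp only [Function.comp_apply, Φ₀.left_inv hq]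
  refine ⟨Φ₀.trans φm, Ψ₀.trans ψm, ?_, ?_, ?_, ?_, ?_, ?_, ?_, ?_⟩
  · rw [OpenPartialHomeomorph.trans_source]
    exact ⟨hp, hpm⟩
  · rw [OpenPartialHomeomorph.coe_trans, Function.comp_apply, hpm0]
  · intro q hq
    rw [OpenPartialHomeomorph.trans_source] at hq ⊢
    refine ⟨hmaps hq.1, ?_⟩
    show Ψ₀ (f q) ∈ ψm.source
    rw [← hFq q hq.1]
    exact hmapsm hq.2
  · rw [OpenPartialHomeomorph.trans_source, OpenPartialHomeomorph.coe_trans]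
    exact hφm'.comp (hΦ₀.mono inter_subset_left) fun q hq => hq.2
  · rw [OpenPartialHomeomorph.trans_symm_eq_symm_trans_symm, OpenPartialHomeomorph.trans_target,
      OpenPartialHomeomorph.coe_trans]
    exact hΦ₀s.comp (hφms'.mono inter_subset_left) fun y hy => hy.2
  · rw [OpenPartialHomeomorph.trans_source, OpenPartialHomeomorph.coe_trans]
    exact hψm'.comp (hΨ₀.mono inter_subset_left) fun q hq => hq.2
  · rw [OpenPartialHomeomorph.trans_symm_eq_symm_trans_symm, OpenPartialHomeomorph.trans_target,
      OpenPartialHomeomorph.coe_trans]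
    exact hΨ₀s.comp (hψms'.mono inter_subset_left) fun y hy => hy.2
  · intro q hq
    rw [OpenPartialHomeomorph.trans_source] at hq
    simp only [OpenPartialHomeomorph.coe_trans, Function.comp_apply]
    have h := hid (Φ₀ q) hq.2
    rw [hFq q hq.1] at h
    exact h

/-- **From Whitney cusp data of the local representative to charts of the manifolds.**
[cite: BaykurSaeki2017, §2.1] -/
theorem exists_whitneyCuspCharts_of_hasWhitneyCuspData {f : X → B}
    {Φ₀ : OpenPartialHomeomorph X (𝔼 4)} {Ψ₀ : OpenPartialHomeomorph B (𝔼 2)}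
    (hΦ₀ : ContMDiffOn (𝓡 4) (𝓡 4) ∞ Φ₀ Φ₀.source)
    (hΦ₀s : ContMDiffOn (𝓡 4) (𝓡 4) ∞ Φ₀.symm Φ₀.target)
    (hΨ₀ : ContMDiffOn (𝓡 2) (𝓡 2) ∞ Ψ₀ Ψ₀.source)
    (hΨ₀s : ContMDiffOn (𝓡 2) (𝓡 2) ∞ Ψ₀.symm Ψ₀.target)
    (hmaps : MapsTo f Φ₀.source Ψ₀.source) {p : X} (hp : p ∈ Φ₀.source)
    (hF : HasWhitneyCuspData (Ψ₀ ∘ f ∘ Φ₀.symm) (Φ₀ p)) :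
    ∃ (φ : OpenPartialHomeomorph X (𝔼 4)) (ψ : OpenPartialHomeomorph B (𝔼 2))
      (h : ℝ × ℝ → ℝ) (U : Set (ℝ × ℝ)) (ε₂ ε₃ : ℝ),
      p ∈ φ.source ∧ φ p = 0 ∧ MapsTo f φ.source ψ.source ∧
      ContMDiffOn (𝓡 4) (𝓡 4) ∞ φ φ.source ∧ ContMDiffOn (𝓡 4) (𝓡 4) ∞ φ.symm φ.target ∧
      ContMDiffOn (𝓡 2) (𝓡 2) ∞ ψ ψ.source ∧ ContMDiffOn (𝓡 2) (𝓡 2) ∞ ψ.symm ψ.target ∧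
      IsOpen U ∧ ContDiffOn ℝ ∞ h U ∧ (∀ q ∈ φ.source, ((φ q) 0, (φ q) 1) ∈ U) ∧
      ε₂ ^ 2 = 1 ∧ ε₃ ^ 2 = 1 ∧
      (∀ q ∈ φ.source, ψ (f q) 0 = φ q 0 ∧
        ψ (f q) 1 = h ((φ q) 0, (φ q) 1) + ε₂ * (φ q) 2 ^ 2 + ε₃ * (φ q) 3 ^ 2) ∧
      h 0 = 0 ∧ fderiv ℝ h 0 ((1 : ℝ), (0 : ℝ)) = 0 ∧ fderiv ℝ h 0 ((0 : ℝ), (1 : ℝ)) = 0 ∧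
      fderiv ℝ (fderiv ℝ h) 0 ((0 : ℝ), (1 : ℝ)) ((0 : ℝ), (1 : ℝ)) = 0 ∧
      fderiv ℝ (fderiv ℝ (fderiv ℝ h)) 0 ((0 : ℝ), (1 : ℝ)) ((0 : ℝ), (1 : ℝ)) ((0 : ℝ), (1 : ℝ)) ≠ 0 ∧
      fderiv ℝ (fderiv ℝ h) 0 ((1 : ℝ), (0 : ℝ)) ((0 : ℝ), (1 : ℝ)) ≠ 0 := by
  obtain ⟨φm, ψm, h, U, ε₂, ε₃, hpm, hpm0, hmapsm, hφm, hφms, hψm, hψms, hU, hh, hφU, hε₂, hε₃,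
    hid, w0, w1, w2, w3, w4, w5⟩ := hF
  have hφm' : ContMDiffOn (𝓡 4) (𝓡 4) ∞ φm φm.source := contMDiffOn_iff_contDiffOn.2 hφm
  have hφms' : ContMDiffOn (𝓡 4) (𝓡 4) ∞ φm.symm φm.target := contMDiffOn_iff_contDiffOn.2 hφms
  have hψm' : ContMDiffOn (𝓡 2) (𝓡 2) ∞ ψm ψm.source := contMDiffOn_iff_contDiffOn.2 hψm
  have hψms' : ContMDiffOn (𝓡 2) (𝓡 2) ∞ ψm.symm ψm.target := contMDiffOn_iff_contDiffOn.2 hψms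
  have hFq : ∀ q ∈ Φ₀.source, (Ψ₀ ∘ f ∘ Φ₀.symm) (Φ₀ q) = Ψ₀ (f q) := fun q hq => by
    simp only [Function.comp_apply, Φ₀.left_inv hq]
  refine ⟨Φ₀.trans φm, Ψ₀.trans ψm, h, U, ε₂, ε₃, ?_, ?_, ?_, ?_, ?_, ?_, ?_, hU, hh, ?_, hε₂, hε₃,
    ?_, w0, w1, w2, w3, w4, w5⟩
  · rw [OpenPartialHomeomorph.trans_source]
    exact ⟨hp, hpm⟩
  · rw [OpenPartialHomeomorph.coe_trans, Function.comp_apply, hpm0]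
  · intro q hq
    rw [OpenPartialHomeomorph.trans_source] at hq ⊢
    refine ⟨hmaps hq.1, ?_⟩
    show Ψ₀ (f q) ∈ ψm.source
    rw [← hFq q hq.1]
    exact hmapsm hq.2
  · rw [OpenPartialHomeomorph.trans_source, OpenPartialHomeomorph.coe_trans]
    exact hφm'.comp (hΦ₀.mono inter_subset_left) fun q hq => hq.2
  · rw [OpenPartialHomeomorph.trans_symm_eq_symm_trans_symm, OpenPartialHomeomorph.trans_target,
      OpenPartialHomeomorph.coe_trans]
    exact hΦ₀s.comp (hφms'.mono inter_subset_left) fun y hy => hy.2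
  · rw [OpenPartialHomeomorph.trans_source, OpenPartialHomeomorph.coe_trans]
    exact hψm'.comp (hΨ₀.mono inter_subset_left) fun q hq => hq.2
  · rw [OpenPartialHomeomorph.trans_symm_eq_symm_trans_symm, OpenPartialHomeomorph.trans_target,
      OpenPartialHomeomorph.coe_trans]
    exact hΨ₀s.comp (hψms'.mono inter_subset_left) fun y hy => hy.2
  · intro q hq
    rw [OpenPartialHomeomorph.trans_source] at hq
    simp only [OpenPartialHomeomorph.coe_trans, Function.comp_apply]
    exact hφU (Φ₀ q) hq.2
  · intro q hq
    rw [OpenPartialHomeomorph.trans_source] at hq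
    simp only [OpenPartialHomeomorph.coe_trans, Function.comp_apply]
    have h' := hid (Φ₀ q) hq.2
    rw [hFq q hq.1] at h'
    exact h'

/-- **Normal forms at the critical points, through a pair of smooth charts.**  If the local
representative `Ψ₀ ∘ f ∘ Φ₀⁻¹` has a global `C^∞` germ representative `G` at `Φ₀ p` which is
`1`-jet transverse and cusp-generic there with `dG ≠ 0`, and `p` is a critical point of `f`,
then `f` has at `p` a fold chart of some signature or Whitney cusp data, in charts of `X` and
`B`. [cite: BaykurSaeki2017, §2.1] -/
theorem foldChart_or_whitneyCuspCharts_of_generic {f : X → B}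
    {Φ₀ : OpenPartialHomeomorph X (𝔼 4)} {Ψ₀ : OpenPartialHomeomorph B (𝔼 2)}
    (hΦ₀ : ContMDiffOn (𝓡 4) (𝓡 4) ∞ Φ₀ Φ₀.source)
    (hΦ₀s : ContMDiffOn (𝓡 4) (𝓡 4) ∞ Φ₀.symm Φ₀.target)
    (hΨ₀ : ContMDiffOn (𝓡 2) (𝓡 2) ∞ Ψ₀ Ψ₀.source)
    (hΨ₀s : ContMDiffOn (𝓡 2) (𝓡 2) ∞ Ψ₀.symm Ψ₀.target)
    (hmaps : MapsTo f Φ₀.source Ψ₀.source) {p : X} (hp : p ∈ Φ₀.source) {G : 𝔼 4 → 𝔼 2}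
    (hG : ContDiff ℝ ∞ G) (hGf : G =ᶠ[𝓝 (Φ₀ p)] (Ψ₀ ∘ f ∘ Φ₀.symm))
    (hne : fderiv ℝ G (Φ₀ p) ≠ 0) (htr : OneJet.IsOneJetTransverseAt G (Φ₀ p))
    (hcg : OneJet.IsCuspGenericAt G (Φ₀ p))
    (hcrit : ¬ Surjective (mfderiv (𝓡 4) (𝓡 2) f p)) :
    (∃ (s₁ s₂ s₃ : ℝ) (φ : OpenPartialHomeomorph X (𝔼 4)) (ψ : OpenPartialHomeomorph B (𝔼 2)),
        s₁ ^ 2 = 1 ∧ s₂ ^ 2 = 1 ∧ s₃ ^ 2 = 1 ∧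
        p ∈ φ.source ∧ φ p = 0 ∧ MapsTo f φ.source ψ.source ∧
        ContMDiffOn (𝓡 4) (𝓡 4) ∞ φ φ.source ∧ ContMDiffOn (𝓡 4) (𝓡 4) ∞ φ.symm φ.target ∧
        ContMDiffOn (𝓡 2) (𝓡 2) ∞ ψ ψ.source ∧ ContMDiffOn (𝓡 2) (𝓡 2) ∞ ψ.symm ψ.target ∧
        ∀ q ∈ φ.source, (ψ (f q)) 0 = (φ q) 0 ∧
          (ψ (f q)) 1 = s₁ * (φ q) 1 ^ 2 + s₂ * (φ q) 2 ^ 2 + s₃ * (φ q) 3 ^ 2) ∨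
      (∃ (φ : OpenPartialHomeomorph X (𝔼 4)) (ψ : OpenPartialHomeomorph B (𝔼 2))
          (h : ℝ × ℝ → ℝ) (U : Set (ℝ × ℝ)) (ε₂ ε₃ : ℝ),
        p ∈ φ.source ∧ φ p = 0 ∧ MapsTo f φ.source ψ.source ∧
        ContMDiffOn (𝓡 4) (𝓡 4) ∞ φ φ.source ∧ ContMDiffOn (𝓡 4) (𝓡 4) ∞ φ.symm φ.target ∧
        ContMDiffOn (𝓡 2) (𝓡 2) ∞ ψ ψ.source ∧ ContMDiffOn (𝓡 2) (𝓡 2) ∞ ψ.symm ψ.target ∧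
        IsOpen U ∧ ContDiffOn ℝ ∞ h U ∧ (∀ q ∈ φ.source, ((φ q) 0, (φ q) 1) ∈ U) ∧
        ε₂ ^ 2 = 1 ∧ ε₃ ^ 2 = 1 ∧
        (∀ q ∈ φ.source, ψ (f q) 0 = φ q 0 ∧
          ψ (f q) 1 = h ((φ q) 0, (φ q) 1) + ε₂ * (φ q) 2 ^ 2 + ε₃ * (φ q) 3 ^ 2) ∧
        h 0 = 0 ∧ fderiv ℝ h 0 ((1 : ℝ), (0 : ℝ)) = 0 ∧ fderiv ℝ h 0 ((0 : ℝ), (1 : ℝ)) = 0 ∧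
        fderiv ℝ (fderiv ℝ h) 0 ((0 : ℝ), (1 : ℝ)) ((0 : ℝ), (1 : ℝ)) = 0 ∧
        fderiv ℝ (fderiv ℝ (fderiv ℝ h)) 0 ((0 : ℝ), (1 : ℝ)) ((0 : ℝ), (1 : ℝ)) ((0 : ℝ), (1 : ℝ))
          ≠ 0 ∧
        fderiv ℝ (fderiv ℝ h) 0 ((1 : ℝ), (0 : ℝ)) ((0 : ℝ), (1 : ℝ)) ≠ 0) := by
  have hsurj : ¬ Surjective (fderiv ℝ G (Φ₀ p)) := by
    rwa [← surjective_mfderiv_iff_of_localRepresentative hΦ₀ hΦ₀s hΨ₀ hΨ₀s hmaps hp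
      (hG.differentiable (by simp) _) hGf]
  rcases OneJet.isFoldPointAt_or_isCuspCandidateAt hsurj hne with hfold | hcc
  · obtain ⟨s₁, s₂, s₃, hs₁, hs₂, hs₃, hchart⟩ := exists_hasFoldChartSig_of_isFoldPointAt hG hne hfold
    obtain ⟨φ, ψ, h1, h2, h3, h4, h5, h6, h7, h8⟩ := exists_foldChartSig_of_hasFoldChartSig hΦ₀
      hΦ₀s hΨ₀ hΨ₀s hmaps hp (hchart.congr_of_eventuallyEq hGf)
    exact Or.inl ⟨s₁, s₂, s₃, φ, ψ, hs₁, hs₂, hs₃, h1, h2, h3, h4, h5, h6, h7, h8⟩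
  · exact Or.inr (exists_whitneyCuspCharts_of_hasWhitneyCuspData hΦ₀ hΦ₀s hΨ₀ hΨ₀s hmaps hp
      ((hasWhitneyCuspData_of_simpleCusp hG hne hcc htr hcg).congr_of_eventuallyEq hGf))

end Transport

/-! ### The manifold statements: plane-valued and sphere-valued generic maps -/

section ManifoldStatement

/-- Local notation for this file: the model space `ℝⁿ = EuclideanSpace ℝ (Fin n)`. -/
local notation "𝔼 " n:arg => EuclideanSpace ℝ (Fin n)

/-- Local notation: the round 2-sphere. -/
local notation "𝕊²" => Metric.sphere (0 : EuclideanSpace ℝ (Fin 3)) 1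

variable {B : Type*} [TopologicalSpace B] [ChartedSpace (𝔼 2) B]

/-- **Generic maps into a surface chart.**  Let `Ψ₀` be a smooth chart of the surface `B` whose
target is all of `ℝ²`.  Then every compact boundaryless `C^∞` 4-manifold `M` carries a `C^∞` map
`g : M → B` with image in `Ψ₀.source` each of whose critical points is a **fold point with
charts** of `M` and `B` (`ψ ∘ g = (φ₀, s₁φ₁² + s₂φ₂² + s₃φ₃²)`, `sᵢ = ±1`) or a **cusp point with
Whitney data** in such charts (`ψ ∘ g = (φ₀, h(φ₀, φ₁) + ε₂φ₂² + ε₃φ₃²)`,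
`h = hₜ = hₓ = hₓₓ = 0`, `hₓₓₓ ≠ 0`, `hₜₓ ≠ 0` at `0`).
[cite: BaykurSaeki2017, §2.1 p. 6, §6 p. 19] -/
theorem exists_generic_map_of_chart [IsManifold (𝓡 2) ∞ B] (Ψ₀ : OpenPartialHomeomorph B (𝔼 2))
    (hΨ₀ : ContMDiffOn (𝓡 2) (𝓡 2) ∞ Ψ₀ Ψ₀.source)
    (hΨ₀s : ContMDiffOn (𝓡 2) (𝓡 2) ∞ Ψ₀.symm Ψ₀.target) (htarget : Ψ₀.target = univ)
    (M : Type*) [TopologicalSpace M] [T2Space M] [CompactSpace M] [ChartedSpace (𝔼 4) M]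
    [IsManifold (𝓡 4) ∞ M] :
    ∃ g : M → B, ContMDiff (𝓡 4) (𝓡 2) ∞ g ∧ (∀ q, g q ∈ Ψ₀.source) ∧ ∀ p : M,
      ¬ Surjective (mfderiv (𝓡 4) (𝓡 2) g p) →
      (∃ (s₁ s₂ s₃ : ℝ) (φ : OpenPartialHomeomorph M (𝔼 4)) (ψ : OpenPartialHomeomorph B (𝔼 2)),
        s₁ ^ 2 = 1 ∧ s₂ ^ 2 = 1 ∧ s₃ ^ 2 = 1 ∧
        p ∈ φ.source ∧ φ p = 0 ∧ MapsTo g φ.source ψ.source ∧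
        ContMDiffOn (𝓡 4) (𝓡 4) ∞ φ φ.source ∧ ContMDiffOn (𝓡 4) (𝓡 4) ∞ φ.symm φ.target ∧
        ContMDiffOn (𝓡 2) (𝓡 2) ∞ ψ ψ.source ∧ ContMDiffOn (𝓡 2) (𝓡 2) ∞ ψ.symm ψ.target ∧
        ∀ q ∈ φ.source, (ψ (g q)) 0 = (φ q) 0 ∧
          (ψ (g q)) 1 = s₁ * (φ q) 1 ^ 2 + s₂ * (φ q) 2 ^ 2 + s₃ * (φ q) 3 ^ 2) ∨
      (∃ (φ : OpenPartialHomeomorph M (𝔼 4)) (ψ : OpenPartialHomeomorph B (𝔼 2))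
          (h : ℝ × ℝ → ℝ) (U : Set (ℝ × ℝ)) (ε₂ ε₃ : ℝ),
        p ∈ φ.source ∧ φ p = 0 ∧ MapsTo g φ.source ψ.source ∧
        ContMDiffOn (𝓡 4) (𝓡 4) ∞ φ φ.source ∧ ContMDiffOn (𝓡 4) (𝓡 4) ∞ φ.symm φ.target ∧
        ContMDiffOn (𝓡 2) (𝓡 2) ∞ ψ ψ.source ∧ ContMDiffOn (𝓡 2) (𝓡 2) ∞ ψ.symm ψ.target ∧
        IsOpen U ∧ ContDiffOn ℝ ∞ h U ∧ (∀ q ∈ φ.source, ((φ q) 0, (φ q) 1) ∈ U) ∧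
        ε₂ ^ 2 = 1 ∧ ε₃ ^ 2 = 1 ∧
        (∀ q ∈ φ.source, ψ (g q) 0 = φ q 0 ∧
          ψ (g q) 1 = h ((φ q) 0, (φ q) 1) + ε₂ * (φ q) 2 ^ 2 + ε₃ * (φ q) 3 ^ 2) ∧
        h 0 = 0 ∧ fderiv ℝ h 0 ((1 : ℝ), (0 : ℝ)) = 0 ∧ fderiv ℝ h 0 ((0 : ℝ), (1 : ℝ)) = 0 ∧
        fderiv ℝ (fderiv ℝ h) 0 ((0 : ℝ), (1 : ℝ)) ((0 : ℝ), (1 : ℝ)) = 0 ∧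
        fderiv ℝ (fderiv ℝ (fderiv ℝ h)) 0 ((0 : ℝ), (1 : ℝ)) ((0 : ℝ), (1 : ℝ)) ((0 : ℝ), (1 : ℝ))
          ≠ 0 ∧
        fderiv ℝ (fderiv ℝ h) 0 ((1 : ℝ), (0 : ℝ)) ((0 : ℝ), (1 : ℝ)) ≠ 0) := by
  obtain ⟨f, hf, hgen⟩ := OneJet.exists_twoGeneric_map M
  have hft : ∀ q, f q ∈ Ψ₀.target := fun q => by simp [htarget]
  set g : M → B := fun q => Ψ₀.symm (f q) with hg
  have hgs : ContMDiff (𝓡 4) (𝓡 2) ∞ g := hΨ₀s.comp_contMDiff hf hft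
  have hgsrc : ∀ q, g q ∈ Ψ₀.source := fun q => Ψ₀.map_target (hft q)
  have hΨg : ∀ q, Ψ₀ (g q) = f q := fun q => Ψ₀.right_inv (hft q)
  refine ⟨g, hgs, hgsrc, fun p hcrit => ?_⟩
  obtain ⟨hne, htr, hcg⟩ := hgen p
  -- the chart of `M` at `p` and a global representative of the germ of `f ∘ φ_p⁻¹`
  set Φ₀ : OpenPartialHomeomorph M (𝔼 4) := chartAt (𝔼 4) p with hΦ₀
  have hΦ₀s : ContMDiffOn (𝓡 4) (𝓡 4) ∞ Φ₀ Φ₀.source := contMDiffOn_chart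
  have hΦ₀ss : ContMDiffOn (𝓡 4) (𝓡 4) ∞ Φ₀.symm Φ₀.target := contMDiffOn_chart_symm
  have hpΦ₀ : p ∈ Φ₀.source := mem_chart_source _ p
  have hrep : (Ψ₀ ∘ g ∘ Φ₀.symm) = f ∘ (extChartAt (𝓡 4) p).symm := by
    funext y
    simp [hΦ₀, hΨg]
  have hpt : extChartAt (𝓡 4) p p = Φ₀ p := by simp [hΦ₀]
  obtain ⟨G, hG, heq⟩ := exists_contDiff_eventuallyEq_planeRep (isOpen_extChartAt_target p)
    (contDiffOn_comp_extChartAt_symm_target (I := 𝓡 4) hf p) (mem_extChartAt_target p)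
  have hne' : fderiv ℝ G (Φ₀ p) ≠ 0 := by rwa [← hpt, heq.fderiv_eq]
  have htr' : OneJet.IsOneJetTransverseAt G (Φ₀ p) :=
    hpt ▸ (OneJet.isOneJetTransverseAt_congr_of_eventuallyEq heq).2 htr
  have hcg' : OneJet.IsCuspGenericAt G (Φ₀ p) :=
    hpt ▸ (OneJet.isCuspGenericAt_congr_of_eventuallyEq heq).2 hcg
  have hGf : G =ᶠ[𝓝 (Φ₀ p)] (Ψ₀ ∘ g ∘ Φ₀.symm) := by
    rw [hrep, ← hpt]
    exact heq
  exact foldChart_or_whitneyCuspCharts_of_generic hΦ₀s hΦ₀ss hΨ₀ hΨ₀s (fun q _ => hgsrc q) hpΦ₀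
    hG hGf hne' htr' hcg' hcrit

/-- **Generic maps of a closed 4-manifold to the plane** (`B = ℝ²`, `Ψ₀ = id`): a `C^∞` map
`f : M → ℝ²` each of whose critical points is a fold point with charts (any signature) or a cusp
point with Whitney data. [cite: BaykurSaeki2017, §2.1 p. 6] -/
theorem exists_generic_map_manifoldNormalForms (M : Type*) [TopologicalSpace M] [T2Space M]
    [CompactSpace M] [ChartedSpace (𝔼 4) M] [IsManifold (𝓡 4) ∞ M] :
    ∃ g : M → 𝔼 2, ContMDiff (𝓡 4) (𝓡 2) ∞ g ∧ ∀ p : M,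
      ¬ Surjective (mfderiv (𝓡 4) (𝓡 2) g p) →
      (∃ (s₁ s₂ s₃ : ℝ) (φ : OpenPartialHomeomorph M (𝔼 4))
          (ψ : OpenPartialHomeomorph (𝔼 2) (𝔼 2)),
        s₁ ^ 2 = 1 ∧ s₂ ^ 2 = 1 ∧ s₃ ^ 2 = 1 ∧
        p ∈ φ.source ∧ φ p = 0 ∧ MapsTo g φ.source ψ.source ∧
        ContMDiffOn (𝓡 4) (𝓡 4) ∞ φ φ.source ∧ ContMDiffOn (𝓡 4) (𝓡 4) ∞ φ.symm φ.target ∧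
        ContMDiffOn (𝓡 2) (𝓡 2) ∞ ψ ψ.source ∧ ContMDiffOn (𝓡 2) (𝓡 2) ∞ ψ.symm ψ.target ∧
        ∀ q ∈ φ.source, (ψ (g q)) 0 = (φ q) 0 ∧
          (ψ (g q)) 1 = s₁ * (φ q) 1 ^ 2 + s₂ * (φ q) 2 ^ 2 + s₃ * (φ q) 3 ^ 2) ∨
      (∃ (φ : OpenPartialHomeomorph M (𝔼 4)) (ψ : OpenPartialHomeomorph (𝔼 2) (𝔼 2))
          (h : ℝ × ℝ → ℝ) (U : Set (ℝ × ℝ)) (ε₂ ε₃ : ℝ),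
        p ∈ φ.source ∧ φ p = 0 ∧ MapsTo g φ.source ψ.source ∧
        ContMDiffOn (𝓡 4) (𝓡 4) ∞ φ φ.source ∧ ContMDiffOn (𝓡 4) (𝓡 4) ∞ φ.symm φ.target ∧
        ContMDiffOn (𝓡 2) (𝓡 2) ∞ ψ ψ.source ∧ ContMDiffOn (𝓡 2) (𝓡 2) ∞ ψ.symm ψ.target ∧
        IsOpen U ∧ ContDiffOn ℝ ∞ h U ∧ (∀ q ∈ φ.source, ((φ q) 0, (φ q) 1) ∈ U) ∧
        ε₂ ^ 2 = 1 ∧ ε₃ ^ 2 = 1 ∧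
        (∀ q ∈ φ.source, ψ (g q) 0 = φ q 0 ∧
          ψ (g q) 1 = h ((φ q) 0, (φ q) 1) + ε₂ * (φ q) 2 ^ 2 + ε₃ * (φ q) 3 ^ 2) ∧
        h 0 = 0 ∧ fderiv ℝ h 0 ((1 : ℝ), (0 : ℝ)) = 0 ∧ fderiv ℝ h 0 ((0 : ℝ), (1 : ℝ)) = 0 ∧
        fderiv ℝ (fderiv ℝ h) 0 ((0 : ℝ), (1 : ℝ)) ((0 : ℝ), (1 : ℝ)) = 0 ∧
        fderiv ℝ (fderiv ℝ (fderiv ℝ h)) 0 ((0 : ℝ), (1 : ℝ)) ((0 : ℝ), (1 : ℝ)) ((0 : ℝ), (1 : ℝ))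
          ≠ 0 ∧
        fderiv ℝ (fderiv ℝ h) 0 ((1 : ℝ), (0 : ℝ)) ((0 : ℝ), (1 : ℝ)) ≠ 0) := by
  obtain ⟨g, hg, -, hnf⟩ := exists_generic_map_of_chart (OpenPartialHomeomorph.refl (𝔼 2))
    contMDiff_id.contMDiffOn (by simpa using contMDiff_id.contMDiffOn) rfl M
  exact ⟨g, hg, hnf⟩

/-- **Generic maps of a closed 4-manifold to the 2-sphere** — the starting point of
Baykur–Saeki's proof of their Thm. 6.1 ("we may start with a generic map `f : X → S²`", §6
p. 19, whose singularities are folds and cusps, §2.1 p. 6): every compact boundaryless `C^∞`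
4-manifold carries a `C^∞` map `g : M → S²` each of whose critical points is a fold point with
charts of `M` and `S²` (`ψ ∘ g = (φ₀, s₁φ₁² + s₂φ₂² + s₃φ₃²)`, `sᵢ = ±1`, definite or indefinite)
or a cusp point with Whitney data in such charts; the cusp chart `(t, x³ + tx ± y² ± z²)` then
follows from Whitney's planar theorem (Golubitsky–Guillemin VI Thm. 2.4, not formalised here).
[cite: BaykurSaeki2017, §2.1 p. 6, §6 p. 19]
[cite: GolubitskyGuillemin1973, Ch. II §4 Thm. 4.9; Ch. III §4 Thm. 4.5; Ch. VI §2, §5 Thm. 5.2] -/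
theorem exists_generic_map_sphere (M : Type*) [TopologicalSpace M] [T2Space M]
    [CompactSpace M] [ChartedSpace (𝔼 4) M] [IsManifold (𝓡 4) ∞ M] :
    ∃ g : M → 𝕊², ContMDiff (𝓡 4) (𝓡 2) ∞ g ∧ ∀ p : M,
      ¬ Surjective (mfderiv (𝓡 4) (𝓡 2) g p) →
      (∃ (s₁ s₂ s₃ : ℝ) (φ : OpenPartialHomeomorph M (𝔼 4)) (ψ : OpenPartialHomeomorph 𝕊² (𝔼 2)),
        s₁ ^ 2 = 1 ∧ s₂ ^ 2 = 1 ∧ s₃ ^ 2 = 1 ∧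
        p ∈ φ.source ∧ φ p = 0 ∧ MapsTo g φ.source ψ.source ∧
        ContMDiffOn (𝓡 4) (𝓡 4) ∞ φ φ.source ∧ ContMDiffOn (𝓡 4) (𝓡 4) ∞ φ.symm φ.target ∧
        ContMDiffOn (𝓡 2) (𝓡 2) ∞ ψ ψ.source ∧ ContMDiffOn (𝓡 2) (𝓡 2) ∞ ψ.symm ψ.target ∧
        ∀ q ∈ φ.source, (ψ (g q)) 0 = (φ q) 0 ∧
          (ψ (g q)) 1 = s₁ * (φ q) 1 ^ 2 + s₂ * (φ q) 2 ^ 2 + s₃ * (φ q) 3 ^ 2) ∨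
      (∃ (φ : OpenPartialHomeomorph M (𝔼 4)) (ψ : OpenPartialHomeomorph 𝕊² (𝔼 2))
          (h : ℝ × ℝ → ℝ) (U : Set (ℝ × ℝ)) (ε₂ ε₃ : ℝ),
        p ∈ φ.source ∧ φ p = 0 ∧ MapsTo g φ.source ψ.source ∧
        ContMDiffOn (𝓡 4) (𝓡 4) ∞ φ φ.source ∧ ContMDiffOn (𝓡 4) (𝓡 4) ∞ φ.symm φ.target ∧
        ContMDiffOn (𝓡 2) (𝓡 2) ∞ ψ ψ.source ∧ ContMDiffOn (𝓡 2) (𝓡 2) ∞ ψ.symm ψ.target ∧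
        IsOpen U ∧ ContDiffOn ℝ ∞ h U ∧ (∀ q ∈ φ.source, ((φ q) 0, (φ q) 1) ∈ U) ∧
        ε₂ ^ 2 = 1 ∧ ε₃ ^ 2 = 1 ∧
        (∀ q ∈ φ.source, ψ (g q) 0 = φ q 0 ∧
          ψ (g q) 1 = h ((φ q) 0, (φ q) 1) + ε₂ * (φ q) 2 ^ 2 + ε₃ * (φ q) 3 ^ 2) ∧
        h 0 = 0 ∧ fderiv ℝ h 0 ((1 : ℝ), (0 : ℝ)) = 0 ∧ fderiv ℝ h 0 ((0 : ℝ), (1 : ℝ)) = 0 ∧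
        fderiv ℝ (fderiv ℝ h) 0 ((0 : ℝ), (1 : ℝ)) ((0 : ℝ), (1 : ℝ)) = 0 ∧
        fderiv ℝ (fderiv ℝ (fderiv ℝ h)) 0 ((0 : ℝ), (1 : ℝ)) ((0 : ℝ), (1 : ℝ)) ((0 : ℝ), (1 : ℝ))
          ≠ 0 ∧
        fderiv ℝ (fderiv ℝ h) 0 ((1 : ℝ), (0 : ℝ)) ((0 : ℝ), (1 : ℝ)) ≠ 0) := by
  -- a stereographic chart of the sphere: smooth with smooth inverse, onto `ℝ²`
  set P₀ : 𝕊² := ⟨EuclideanSpace.single (0 : Fin 3) (1 : ℝ), by simp⟩ with hP₀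
  set Ψ₀ : OpenPartialHomeomorph 𝕊² (𝔼 2) := chartAt (𝔼 2) P₀ with hΨ₀
  have hΨ₀s : ContMDiffOn (𝓡 2) (𝓡 2) ∞ Ψ₀ Ψ₀.source := contMDiffOn_chart
  have hΨ₀ss : ContMDiffOn (𝓡 2) (𝓡 2) ∞ Ψ₀.symm Ψ₀.target := contMDiffOn_chart_symm
  have htarget : Ψ₀.target = univ := by
    haveI : Fact (Module.finrank ℝ (𝔼 3) = 2 + 1) := ⟨by simp⟩
    show (stereographic' 2 (-P₀)).target = univ
    exact stereographic'_target (-P₀)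
  obtain ⟨g, hg, -, hnf⟩ := exists_generic_map_of_chart Ψ₀ hΨ₀s hΨ₀ss htarget M
  exact ⟨g, hg, hnf⟩

end ManifoldStatement

end Literature.Topology.FourManifolds
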